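import Summits.BirchSwinnertonDyer.BirchSwinnertonDyer.Theorems.ManinLocalTwoThreeMultiShiftSpanOldform
import HarnessLib

/-!
# Route `ManinLocalTwoThree`, cruxes C2 `ManinOddAtFour` (stmt-BirchSwinnertonDyer-22967) and C3 `ManinPrimeToThreeAtNine`
# (stmt-BirchSwinnertonDyer-22968): the generation laws E-es-22 / E-es-19 in the vocabulary of the tree's Ihara lemma —
# statements about the image of the degeneracy push-forwards on integral period homology `H₁(X₀(·), ℤ) ⊆ S₂^∨`
# (line prover p3; helper, unconditional edges)

With `H₁(X₀(M), ℤ) = periodHomology M` and the push-forwards `(degeneracyMap0 N M e 2).dualMap` (`…^∨`, as in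
`ribet1984_iharaLemma`), the oldform-lattice forms (`…ShiftSpanOldform`, `…MultiShiftSpanOldform`) read:
* `shiftClassGenerationThree_iff_degeneracyImage` — **E-es-19 ⟺** for every `W`-newform `f` (`9 ∣ N`, `W[3]` irreducible)
  some `m`, `3 ∤ m`, has: for every `x ∈ H₁(X₀(N), ℤ)` there is `z ∈ H₁(X₀(3N), ℤ)` with
  `m·x(f) = (ι₃^∨ z)(f) − (ι₁^∨ z)(f)` — the `f`-component of `coker(β_* − α_* : H₁(X₀(3N), ℤ) → H₁(X₀(N), ℤ))` has order prime
  to `3`;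
* `multiShiftClassGenerationTwo_iff_degeneracyImage` — **E-es-22 ⟺** for every `W`-newform `f` (`4 ∣ N`, `W[2]` irreducible)
  some odd `m` has: for every `x ∈ H₁(X₀(N), ℤ)` there is `z ∈ H₁(X₀(8N²), ℤ)` with
  `m·x(f) = Σ_{T ⊆ Gen(N)} (−1)^{|T|} (ι_{∏T}^∨ z)(f)`.
So both generation laws are Eisenstein-type cokernel statements for degeneracy maps at primes DIVIDING the level — the
exact analogue, at `p ∣ M`, of the tree's named fact `ribet1984_iharaLemma` (`p ∤ M`).  Nothing about BSD, Manin's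
conjecture, E-es-19 or E-es-22 themselves is proved here.
-/

set_option autoImplicit false
set_option linter.dupNamespace false

noncomputable section

open scoped Classical MatrixGroups ModularForm BigOperators

open CongruenceSubgroup Matrix.SpecialLinearGroup ModularGroup
  Literature.NumberTheory.EllipticCurves Literature.NumberTheory.EllipticCurves.ModularForms
  Summit.BirchSwinnertonDyer.Rank1Residual.ManinAdditive

namespace Summit.BirchSwinnertonDyer.BirchSwinnertonDyer.Theorems.ManinLocalTwoThree

section DegeneracyImage

/-- `Λ_g = {z(g) : z ∈ H₁(X₀(M), ℤ)}` (`periodLattice_eq_map_periodHomology`). [cite: CremonaAlgorithms1997, §2.10] -/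
theorem mem_periodLattice_iff_exists_periodHomology {M : ℕ} [NeZero M] (g : CuspForm (Gamma0 M) 2) (w : ℂ) :
    w ∈ periodLattice g ↔ ∃ z ∈ periodHomology M, z g = w := by
  rw [periodLattice_eq_map_periodHomology, AddSubgroup.mem_map]
  constructor
  · rintro ⟨z, hz, h⟩
    exact ⟨z, hz, h⟩
  · rintro ⟨z, hz, h⟩
    exact ⟨z, hz, h⟩

/-- **E-es-19 as a cokernel statement for `β_* − α_* : H₁(X₀(3N), ℤ) → H₁(X₀(N), ℤ)`.** [folklore] -/
theorem shiftClassGenerationThree_iff_degeneracyImage :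
    ShiftClassGenerationThree ↔
      ∀ (W : WeierstrassCurve ℚ) [W.IsElliptic] {N : ℕ} [NeZero N] (f : CuspForm (Gamma0 N) 2),
        IsNewformOf W f → 3 ^ 2 ∣ N → W.HasIrreducibleModPGaloisRep 3 →
        ∃ m : ℕ, ¬ 3 ∣ m ∧ ∀ x ∈ periodHomology N, ∃ z ∈ periodHomology (3 * N),
          (m : ℂ) * x f = (degeneracyMap0 N (3 * N) 3 2).dualMap z f - (degeneracyMap0 N (3 * N) 1 2).dualMap z f := by
  rw [shiftClassGenerationThree_iff_oldformLattice]
  constructor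
  · intro H W _ N _ f hf h9 hirr
    obtain ⟨m, hm, hgen⟩ := H W f hf h9 hirr
    refine ⟨m, hm, fun x hx => ?_⟩
    have hw : x f ∈ periodLattice f := (mem_periodLattice_iff_exists_periodHomology f _).mpr ⟨x, hx, rfl⟩
    obtain ⟨z, hz, hzf⟩ := (mem_periodLattice_iff_exists_periodHomology _ _).mp (hgen _ hw)
    refine ⟨z, hz, ?_⟩
    rw [← hzf, map_sub, LinearMap.dualMap_apply, LinearMap.dualMap_apply]
  · intro H W _ N _ f hf h9 hirr
    obtain ⟨m, hm, hgen⟩ := H W f hf h9 hirr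
    refine ⟨m, hm, fun w hw => ?_⟩
    obtain ⟨x, hx, rfl⟩ := (mem_periodLattice_iff_exists_periodHomology f w).mp hw
    obtain ⟨z, hz, hzf⟩ := hgen x hx
    refine (mem_periodLattice_iff_exists_periodHomology _ _).mpr ⟨z, hz, ?_⟩
    rw [hzf, map_sub, LinearMap.dualMap_apply, LinearMap.dualMap_apply]

/-- **E-es-22 as a cokernel statement for `Σ_T (−1)^{|T|} (ι_{∏T})_* : H₁(X₀(8N²), ℤ) → H₁(X₀(N), ℤ)`.** [folklore] -/
theorem multiShiftClassGenerationTwo_iff_degeneracyImage :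
    MultiShiftClassGenerationTwo ↔
      ∀ (W : WeierstrassCurve ℚ) [W.IsElliptic] {N : ℕ} [NeZero N] (f : CuspForm (Gamma0 N) 2),
        IsNewformOf W f → 2 ^ 2 ∣ N → W.HasIrreducibleModPGaloisRep 2 →
        ∃ m : ℕ, ¬ 2 ∣ m ∧ ∀ x ∈ periodHomology N, ∃ z ∈ periodHomology (8 * N ^ 2),
          (m : ℂ) * x f = ∑ T ∈ (insert 8 (N.primeFactors.filter fun q => ¬ q ^ 2 ∣ N)).powerset,
            (-1 : ℂ) ^ T.card * (degeneracyMap0 N (8 * N ^ 2) (∏ t ∈ T, t - 1 + 1) 2).dualMap z f := by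
  rw [multiShiftClassGenerationTwo_iff_oldformLattice]
  have key : ∀ {N : ℕ} [NeZero N] (f : CuspForm (Gamma0 N) 2) (z : Module.Dual ℂ (CuspForm (Gamma0 (8 * N ^ 2)) 2)),
      z (∑ T ∈ (insert 8 (N.primeFactors.filter fun q => ¬ q ^ 2 ∣ N)).powerset,
          (-1 : ℂ) ^ T.card • degeneracyMap0 N (8 * N ^ 2) (∏ t ∈ T, t - 1 + 1) 2 f) =
        ∑ T ∈ (insert 8 (N.primeFactors.filter fun q => ¬ q ^ 2 ∣ N)).powerset,
          (-1 : ℂ) ^ T.card * (degeneracyMap0 N (8 * N ^ 2) (∏ t ∈ T, t - 1 + 1) 2).dualMap z f := by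
    intro N _ f z
    rw [map_sum]
    refine Finset.sum_congr rfl fun T _ => ?_
    rw [map_smul, smul_eq_mul, LinearMap.dualMap_apply]
  constructor
  · intro H W _ N _ f hf h4 hirr
    obtain ⟨m, hm, hgen⟩ := H W f hf h4 hirr
    refine ⟨m, hm, fun x hx => ?_⟩
    have hw : x f ∈ periodLattice f := (mem_periodLattice_iff_exists_periodHomology f _).mpr ⟨x, hx, rfl⟩
    obtain ⟨z, hz, hzf⟩ := (mem_periodLattice_iff_exists_periodHomology _ _).mp (hgen _ hw)
    exact ⟨z, hz, by rw [← hzf, key]⟩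
  · intro H W _ N _ f hf h4 hirr
    obtain ⟨m, hm, hgen⟩ := H W f hf h4 hirr
    refine ⟨m, hm, fun w hw => ?_⟩
    obtain ⟨x, hx, rfl⟩ := (mem_periodLattice_iff_exists_periodHomology f w).mp hw
    obtain ⟨z, hz, hzf⟩ := hgen x hx
    exact (mem_periodLattice_iff_exists_periodHomology _ _).mpr ⟨z, hz, by rw [hzf, key]⟩

end DegeneracyImage

end Summit.BirchSwinnertonDyer.BirchSwinnertonDyer.Theorems.ManinLocalTwoThree

end
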